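import Summits.QuantumFields.YangMills.Theorems.SwapVirialDeficitSectorLaplaceEndGaussGlue
import Summits.QuantumFields.YangMills.Theorems.SwapVirialDeficitBlowUpGnomonicFollowerLaplaceCeiling
import HarnessLib

/-!
# N2b — THE FAR CASE of the pointwise fibre bound for `stub_end_gaussCore`: at a leader point where T1's near-flat admissibility FAILS, the follower integral of
# `bDensity·e^{−bF̂}` is `≤ (e^{−(5b/6)κ_far}·∫piWeight) × [the three leader Gaussians]`
# (skeleton ➎; LEAD sfw-p2 g99 ruling 2026-08-31 23:12Z «N2 = N2a ⊔ N2b; N2b → w3»; free-hands support of ⟨stmt-QuantumFields-24197⟩ `SwapVirialDeficit.SwapGluedStiffness`)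

T1 (w2 ✓`follower_laplace_ceiling`) is admissible at a leader point `η₀ = (ℓ, 0)` when the leader commutators and σ-relations are `≤ s_T` in Frobenius norm and
`F̂(η₀) ≤ κ_flat`.  If that fails, some leader relation exceeds `min(s_T, √(κ_flat/(300L⁴)))` (✓`gnoDeficit_leaderPoint_le`, contrapositive), and since the leader
tuple does not see the followers (`rfl`), ✓`comm_frobNorm_sq_le_chartDeficit` ∕ ✓`sigmaRel_frobNorm_sq_le_chartDeficit` give the UNIFORM floor
`F̂(ℓ, F) ≥ κ_far := min(s_T², κ_flat/(300L⁴))/(3600L⁶)` for EVERY follower configuration `F` (`endGauss_far_floor`).  Splitting `e^{−bF̂} = e^{−(b/6)F̂}·e^{−(5b/6)F̂}`,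
the first factor is the three leader Gaussians (✓`endGauss_exp_three_floor`, `c = b/(6·55200L⁶)`), the second is `≤ e^{−(5b/6)κ_far}`; the density keeps `piWeight F`
(`bDensity_blocks_le_piWeight`) so the follower integral is the finite constant `∫⁻ piWeight`:
* ★★★ `endGauss_N2_far` — in EXACTLY the letters of ✓`lintegral_hubSlab_leader_le`'s `hF` (`pt F = (t 0, ((t1∷u),(t2∷v)), z, F)`), for any `g ≤ ofReal(e^{−bF̂(hubAt δ 1,ε,·)})`:
  `∫⁻ F, ofReal(bDensity(pt F))·g(pt F) ≤ (ofReal(e^{−(5b/6)κ_far})·∫⁻ F, ofReal(piWeight F)) · X_c(u,t) · Y_c(v,t) · Z_c(z)`.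
So with `T ≥ T_far := ofReal(e^{−(5b/6)κ_far})·∫⁻ piWeight` the `hN2` weight `A·D + T` dominates the far case (glue: `by_cases` on admissibility, LEAD 23:12Z).

HONEST LABEL: bookkeeping on landed inequalities; N2a (near case, g48∕w2), the glue and the final plug of `stub_end_gaussCore`, and `stub_core_tip` are OPEN ⟹ ⟨24197⟩ ∕ ⟨24194⟩
OPEN; own crux ⟨22884⟩ OPEN (blocked-on ⟨19935⟩); the Yang–Mills mass gap is NOT proved; no summit is proved by a line.  THEOREMS ONLY (0 `def`, 0 `sorry`), standard axioms.
Width seat ym-line-sfw-p2-w3 g67 (cell ym-idea-1, free hands), `--supports stmt-QuantumFields-24197`.  References: [folklore]; [cite: Luscher1983, §2].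
-/

set_option autoImplicit false

noncomputable section

open MeasureTheory Quaternion Set
open scoped Quaternion BigOperators ENNReal
open Literature.MathematicalPhysics.QuantumLattice
open Literature.MathematicalPhysics.QuantumFieldTheory hiding SU2

namespace Summit.QuantumFields.YangMills.Theorems.SwapVirialDeficit.BlowUpRing

open Summit.QuantumFields.YangMills.Theorems.FemtoTransferGap
open Summit.QuantumFields.YangMills.Theorems.FemtoTransferGap.TT
open Summit.QuantumFields.YangMills.Theorems.VirialFluxGap.RingDeficit
open Summit.QuantumFields.YangMills.Theorems.SwapVirialDeficit.SwapRing
open Summit.QuantumFields.YangMills.Theorems.SwapVirialDeficit.Gnomonic (normSq3 gnomonicWeight piWeight piWeight_pos piWeight_le_one continuous_piWeight)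

variable {L : ℕ} [NeZero L]

/-! ## §1 The uniform far floor -/

/-- A leader relation (commutator) exceeding `s` in Frobenius norm floors the deficit for EVERY follower configuration: `s²/(3600L⁶) ≤ F̂(a, ε, ((x,y),(z,F)))`.
The leader tuple of the chart point does not depend on `F` (`rfl`). [folklore] -/
theorem gnoDeficit_ge_of_comm_gt {a : ℍ} (ε : GnoSign L) (x y z : Fin 3 → ℝ) (F : Fol L → Fin 3 → ℝ) {s : ℝ} (hs : 0 ≤ s) (μ ν : Fin 3)
    (h : s < frobNorm ((((blowUpPoint 1 (gnomonicPoint a ε (((x, y), (z, (0 : Fol L → Fin 3 → ℝ))) : GnoCoord L))).1 (Fin.castSucc μ) *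
        (blowUpPoint 1 (gnomonicPoint a ε (((x, y), (z, (0 : Fol L → Fin 3 → ℝ))) : GnoCoord L))).1 (Fin.castSucc ν) : SU2) : Matrix (Fin 2) (Fin 2) ℂ) -
        (((blowUpPoint 1 (gnomonicPoint a ε (((x, y), (z, (0 : Fol L → Fin 3 → ℝ))) : GnoCoord L))).1 (Fin.castSucc ν) *
        (blowUpPoint 1 (gnomonicPoint a ε (((x, y), (z, (0 : Fol L → Fin 3 → ℝ))) : GnoCoord L))).1 (Fin.castSucc μ) : SU2) : Matrix (Fin 2) (Fin 2) ℂ))) :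
    s ^ 2 / (3600 * (L : ℝ) ^ 6) ≤ gnoDeficit (fun _ => false) (fun _ => 1) a ε (((x, y), (z, F)) : GnoCoord L) := by
  have hL : (0 : ℝ) < 3600 * (L : ℝ) ^ 6 := by have := NeZero.pos L; positivity
  have hlead : (blowUpPoint 1 (gnomonicPoint a ε (((x, y), (z, F)) : GnoCoord L))).1 =
      (blowUpPoint 1 (gnomonicPoint a ε (((x, y), (z, (0 : Fol L → Fin 3 → ℝ))) : GnoCoord L))).1 := rfl
  have hc := comm_frobNorm_sq_le_chartDeficit (L := L) (blowUpPoint (L := L) 1 (gnomonicPoint a ε (((x, y), (z, F)) : GnoCoord L))) μ ν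
  rw [hlead] at hc
  have hsq : s ^ 2 ≤ frobNorm ((((blowUpPoint 1 (gnomonicPoint a ε (((x, y), (z, (0 : Fol L → Fin 3 → ℝ))) : GnoCoord L))).1 (Fin.castSucc μ) *
        (blowUpPoint 1 (gnomonicPoint a ε (((x, y), (z, (0 : Fol L → Fin 3 → ℝ))) : GnoCoord L))).1 (Fin.castSucc ν) : SU2) : Matrix (Fin 2) (Fin 2) ℂ) -
        (((blowUpPoint 1 (gnomonicPoint a ε (((x, y), (z, (0 : Fol L → Fin 3 → ℝ))) : GnoCoord L))).1 (Fin.castSucc ν) *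
        (blowUpPoint 1 (gnomonicPoint a ε (((x, y), (z, (0 : Fol L → Fin 3 → ℝ))) : GnoCoord L))).1 (Fin.castSucc μ) : SU2) : Matrix (Fin 2) (Fin 2) ℂ)) ^ 2 :=
    pow_le_pow_left₀ hs h.le 2
  rw [div_le_iff₀ hL]
  unfold gnoDeficit
  exact hsq.trans (by linarith [hc])

/-- Same for a σ-relation exceeding `s`. [folklore] -/
theorem gnoDeficit_ge_of_sigmaRel_gt {a : ℍ} (ε : GnoSign L) (x y z : Fin 3 → ℝ) (F : Fol L → Fin 3 → ℝ) {s : ℝ} (hs : 0 ≤ s) (μ : Fin 3)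
    (h : s < frobNorm ((((blowUpPoint 1 (gnomonicPoint a ε (((x, y), (z, (0 : Fol L → Fin 3 → ℝ))) : GnoCoord L))).1 (Fin.last 3) *
        (blowUpPoint 1 (gnomonicPoint a ε (((x, y), (z, (0 : Fol L → Fin 3 → ℝ))) : GnoCoord L))).1 (Fin.castSucc (Equiv.swap (0 : Fin 3) 1 μ)) : SU2) :
          Matrix (Fin 2) (Fin 2) ℂ) -
        (((blowUpPoint 1 (gnomonicPoint a ε (((x, y), (z, (0 : Fol L → Fin 3 → ℝ))) : GnoCoord L))).1 (Fin.castSucc μ) *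
        (blowUpPoint 1 (gnomonicPoint a ε (((x, y), (z, (0 : Fol L → Fin 3 → ℝ))) : GnoCoord L))).1 (Fin.last 3) : SU2) : Matrix (Fin 2) (Fin 2) ℂ))) :
    s ^ 2 / (3600 * (L : ℝ) ^ 6) ≤ gnoDeficit (fun _ => false) (fun _ => 1) a ε (((x, y), (z, F)) : GnoCoord L) := by
  have hL : (0 : ℝ) < 3600 * (L : ℝ) ^ 6 := by have := NeZero.pos L; positivity
  have hlead : (blowUpPoint 1 (gnomonicPoint a ε (((x, y), (z, F)) : GnoCoord L))).1 =
      (blowUpPoint 1 (gnomonicPoint a ε (((x, y), (z, (0 : Fol L → Fin 3 → ℝ))) : GnoCoord L))).1 := rfl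
  have hc := sigmaRel_frobNorm_sq_le_chartDeficit (L := L) (blowUpPoint (L := L) 1 (gnomonicPoint a ε (((x, y), (z, F)) : GnoCoord L))) μ
  rw [hlead] at hc
  have hsq : s ^ 2 ≤ frobNorm ((((blowUpPoint 1 (gnomonicPoint a ε (((x, y), (z, (0 : Fol L → Fin 3 → ℝ))) : GnoCoord L))).1 (Fin.last 3) *
        (blowUpPoint 1 (gnomonicPoint a ε (((x, y), (z, (0 : Fol L → Fin 3 → ℝ))) : GnoCoord L))).1 (Fin.castSucc (Equiv.swap (0 : Fin 3) 1 μ)) : SU2) :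
          Matrix (Fin 2) (Fin 2) ℂ) -
        (((blowUpPoint 1 (gnomonicPoint a ε (((x, y), (z, (0 : Fol L → Fin 3 → ℝ))) : GnoCoord L))).1 (Fin.castSucc μ) *
        (blowUpPoint 1 (gnomonicPoint a ε (((x, y), (z, (0 : Fol L → Fin 3 → ℝ))) : GnoCoord L))).1 (Fin.last 3) : SU2) : Matrix (Fin 2) (Fin 2) ℂ)) ^ 2 :=
    pow_le_pow_left₀ hs h.le 2
  rw [div_le_iff₀ hL]
  unfold gnoDeficit
  exact hsq.trans (by linarith [hc])

/-- ★ **THE FAR FLOOR**: if T1's admissibility (`commutators ≤ s_T`, `σ-relations ≤ s_T`, `F̂(ℓ,0) ≤ κ_flat`) FAILS at the leader point `(ℓ, 0)` (followers' signs `+`),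
then `κ_far = min(s_T², κ_flat/(300L⁴))/(3600L⁶) ≤ F̂(a, ε, (ℓ, F))` for EVERY `F`. [folklore] -/
theorem endGauss_far_floor {a : ℍ} (ε : GnoSign L) (hε : ε.2.2 = fun _ => true) (x y z : Fin 3 → ℝ) {sT κf : ℝ} (hsT : 0 ≤ sT) (hκf : 0 ≤ κf)
    (hfar : ¬ ((∀ μ ν : Fin 3, frobNorm ((((blowUpPoint 1 (gnomonicPoint a ε (((x, y), (z, (0 : Fol L → Fin 3 → ℝ))) : GnoCoord L))).1 (Fin.castSucc μ) *
        (blowUpPoint 1 (gnomonicPoint a ε (((x, y), (z, (0 : Fol L → Fin 3 → ℝ))) : GnoCoord L))).1 (Fin.castSucc ν) : SU2) : Matrix (Fin 2) (Fin 2) ℂ) -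
        (((blowUpPoint 1 (gnomonicPoint a ε (((x, y), (z, (0 : Fol L → Fin 3 → ℝ))) : GnoCoord L))).1 (Fin.castSucc ν) *
        (blowUpPoint 1 (gnomonicPoint a ε (((x, y), (z, (0 : Fol L → Fin 3 → ℝ))) : GnoCoord L))).1 (Fin.castSucc μ) : SU2) : Matrix (Fin 2) (Fin 2) ℂ)) ≤ sT) ∧
      (∀ μ : Fin 3, frobNorm ((((blowUpPoint 1 (gnomonicPoint a ε (((x, y), (z, (0 : Fol L → Fin 3 → ℝ))) : GnoCoord L))).1 (Fin.last 3) *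
        (blowUpPoint 1 (gnomonicPoint a ε (((x, y), (z, (0 : Fol L → Fin 3 → ℝ))) : GnoCoord L))).1 (Fin.castSucc (Equiv.swap (0 : Fin 3) 1 μ)) : SU2) :
          Matrix (Fin 2) (Fin 2) ℂ) -
        (((blowUpPoint 1 (gnomonicPoint a ε (((x, y), (z, (0 : Fol L → Fin 3 → ℝ))) : GnoCoord L))).1 (Fin.castSucc μ) *
        (blowUpPoint 1 (gnomonicPoint a ε (((x, y), (z, (0 : Fol L → Fin 3 → ℝ))) : GnoCoord L))).1 (Fin.last 3) : SU2) : Matrix (Fin 2) (Fin 2) ℂ)) ≤ sT) ∧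
      gnoDeficit (fun _ => false) (fun _ => 1) a ε (((x, y), (z, (0 : Fol L → Fin 3 → ℝ))) : GnoCoord L) ≤ κf))
    (F : Fol L → Fin 3 → ℝ) :
    min (sT ^ 2) (κf / (300 * (L : ℝ) ^ 4)) / (3600 * (L : ℝ) ^ 6) ≤ gnoDeficit (fun _ => false) (fun _ => 1) a ε (((x, y), (z, F)) : GnoCoord L) := by
  have hL0 : (0 : ℝ) < (L : ℝ) := by exact_mod_cast NeZero.pos L
  have hL4 : (0 : ℝ) < 300 * (L : ℝ) ^ 4 := by positivity
  have hL6 : (0 : ℝ) < 3600 * (L : ℝ) ^ 6 := by positivity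
  -- a relation above `s′ := min(sT, √(κf/(300L⁴)))`
  set s' : ℝ := Real.sqrt (min (sT ^ 2) (κf / (300 * (L : ℝ) ^ 4))) with hs'
  have hs'0 : 0 ≤ s' := Real.sqrt_nonneg _
  have hmin0 : 0 ≤ min (sT ^ 2) (κf / (300 * (L : ℝ) ^ 4)) := le_min (sq_nonneg _) (div_nonneg hκf hL4.le)
  have hs'2 : s' ^ 2 = min (sT ^ 2) (κf / (300 * (L : ℝ) ^ 4)) := Real.sq_sqrt hmin0
  have hs'T : s' ≤ sT := by
    rw [← Real.sqrt_sq hsT]; exact Real.sqrt_le_sqrt (min_le_left _ _)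
  have hs'κ : 300 * (L : ℝ) ^ 4 * s' ^ 2 ≤ κf := by
    rw [hs'2]; have := min_le_right (sT ^ 2) (κf / (300 * (L : ℝ) ^ 4)); rw [le_div_iff₀ hL4] at this; linarith
  -- some relation exceeds `s'`
  have hex : (∃ μ ν : Fin 3, s' < frobNorm ((((blowUpPoint 1 (gnomonicPoint a ε (((x, y), (z, (0 : Fol L → Fin 3 → ℝ))) : GnoCoord L))).1 (Fin.castSucc μ) *
        (blowUpPoint 1 (gnomonicPoint a ε (((x, y), (z, (0 : Fol L → Fin 3 → ℝ))) : GnoCoord L))).1 (Fin.castSucc ν) : SU2) : Matrix (Fin 2) (Fin 2) ℂ) -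
        (((blowUpPoint 1 (gnomonicPoint a ε (((x, y), (z, (0 : Fol L → Fin 3 → ℝ))) : GnoCoord L))).1 (Fin.castSucc ν) *
        (blowUpPoint 1 (gnomonicPoint a ε (((x, y), (z, (0 : Fol L → Fin 3 → ℝ))) : GnoCoord L))).1 (Fin.castSucc μ) : SU2) : Matrix (Fin 2) (Fin 2) ℂ))) ∨
      (∃ μ : Fin 3, s' < frobNorm ((((blowUpPoint 1 (gnomonicPoint a ε (((x, y), (z, (0 : Fol L → Fin 3 → ℝ))) : GnoCoord L))).1 (Fin.last 3) *
        (blowUpPoint 1 (gnomonicPoint a ε (((x, y), (z, (0 : Fol L → Fin 3 → ℝ))) : GnoCoord L))).1 (Fin.castSucc (Equiv.swap (0 : Fin 3) 1 μ)) : SU2) :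
          Matrix (Fin 2) (Fin 2) ℂ) -
        (((blowUpPoint 1 (gnomonicPoint a ε (((x, y), (z, (0 : Fol L → Fin 3 → ℝ))) : GnoCoord L))).1 (Fin.castSucc μ) *
        (blowUpPoint 1 (gnomonicPoint a ε (((x, y), (z, (0 : Fol L → Fin 3 → ℝ))) : GnoCoord L))).1 (Fin.last 3) : SU2) : Matrix (Fin 2) (Fin 2) ℂ))) := by
    by_contra hno
    push Not at hno
    obtain ⟨hC, hS⟩ := hno
    apply hfar
    refine ⟨fun μ ν => (hC μ ν).trans hs'T, fun μ => (hS μ).trans hs'T, ?_⟩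
    have h := gnoDeficit_leaderPoint_le (L := L) a ε hε (((x, y), (z, (0 : Fol L → Fin 3 → ℝ))) : GnoCoord L) rfl hs'0 hC hS
    linarith
  have hgoal : s' ^ 2 / (3600 * (L : ℝ) ^ 6) ≤ gnoDeficit (fun _ => false) (fun _ => 1) a ε (((x, y), (z, F)) : GnoCoord L) := by
    rcases hex with ⟨μ, ν, h⟩ | ⟨μ, h⟩
    · exact gnoDeficit_ge_of_comm_gt ε x y z F hs'0 μ ν h
    · exact gnoDeficit_ge_of_sigmaRel_gt ε x y z F hs'0 μ h
  rwa [hs'2] at hgoal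

/-! ## §2 The far-case fibre bound in the `hF` letters -/

omit [NeZero L] in
/-- Five `ofReal` factors with the first four non-negative merge into one. [folklore] -/
theorem ofReal_mul5 {a b c d e : ℝ} (ha : 0 ≤ a) (hb : 0 ≤ b) (hc : 0 ≤ c) (hd : 0 ≤ d) :
    ENNReal.ofReal a * ENNReal.ofReal b * ENNReal.ofReal c * ENNReal.ofReal d * ENNReal.ofReal e = ENNReal.ofReal (a * b * c * d * e) := by
  rw [ENNReal.ofReal_mul (by positivity : 0 ≤ a * b * c * d), ENNReal.ofReal_mul (by positivity : 0 ≤ a * b * c),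
    ENNReal.ofReal_mul (by positivity : 0 ≤ a * b), ENNReal.ofReal_mul ha]

set_option maxHeartbeats 400000 in
/-- The B-density in block letters keeping the follower weight: `ofReal(bDensity) ≤ ofReal(X-weight)·ofReal(Y-weight)·ofReal(gnomonicWeight z)·ofReal(piWeight F)`. [folklore] -/
theorem bDensity_blocks_le_piWeight (δ : ℝ) (u : ℝ × ℝ) (t : Fin 3 → ℝ) (v : Fin 2 → ℝ) (z : Fin 3 → ℝ) (F : Fol L → Fin 3 → ℝ) :
    ENNReal.ofReal (((1 + δ ^ 2)⁻¹) ^ 2 * gnoDensity ((((![t 1, u.1, u.2] : Fin 3 → ℝ), (![t 2, v 0, v 1] : Fin 3 → ℝ)), (z, F)) : GnoCoord L)) ≤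
      ENNReal.ofReal (((1 + t 1 ^ 2 + (u.1 ^ 2 + u.2 ^ 2)) ^ 2)⁻¹) * ENNReal.ofReal (((1 + t 2 ^ 2 + (v 0 ^ 2 + v 1 ^ 2)) ^ 2)⁻¹) * ENNReal.ofReal (gnomonicWeight z) *
        ENNReal.ofReal (piWeight F) := by
  have hA : 0 ≤ ((1 + t 1 ^ 2 + (u.1 ^ 2 + u.2 ^ 2)) ^ 2)⁻¹ := by positivity
  have hB : 0 ≤ ((1 + t 2 ^ 2 + (v 0 ^ 2 + v 1 ^ 2)) ^ 2)⁻¹ := by positivity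
  have hw : 0 ≤ gnomonicWeight z := (Gnomonic.gnomonicWeight_pos z).le
  have hp0 : 0 ≤ piWeight F := (piWeight_pos F).le
  rw [bDensity_blocks_eq, ← ENNReal.ofReal_mul hA, ← ENNReal.ofReal_mul (mul_nonneg hA hB), ← ENNReal.ofReal_mul (mul_nonneg (mul_nonneg hA hB) hw)]
  refine ENNReal.ofReal_le_ofReal ?_
  have h1 : ((1 + δ ^ 2)⁻¹) ^ 2 ≤ 1 := by
    have : (1 + δ ^ 2)⁻¹ ≤ 1 := inv_le_one_of_one_le₀ (by nlinarith [sq_nonneg δ])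
    have h0 : 0 ≤ (1 + δ ^ 2)⁻¹ := by positivity
    nlinarith
  have hABwp : 0 ≤ ((1 + t 1 ^ 2 + (u.1 ^ 2 + u.2 ^ 2)) ^ 2)⁻¹ * (((1 + t 2 ^ 2 + (v 0 ^ 2 + v 1 ^ 2)) ^ 2)⁻¹ * (gnomonicWeight z * piWeight F)) := by positivity
  calc ((1 + δ ^ 2)⁻¹) ^ 2 * (((1 + t 1 ^ 2 + (u.1 ^ 2 + u.2 ^ 2)) ^ 2)⁻¹ * (((1 + t 2 ^ 2 + (v 0 ^ 2 + v 1 ^ 2)) ^ 2)⁻¹ * (gnomonicWeight z * piWeight F)))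
      ≤ 1 * (((1 + t 1 ^ 2 + (u.1 ^ 2 + u.2 ^ 2)) ^ 2)⁻¹ * (((1 + t 2 ^ 2 + (v 0 ^ 2 + v 1 ^ 2)) ^ 2)⁻¹ * (gnomonicWeight z * piWeight F))) :=
        mul_le_mul_of_nonneg_right h1 hABwp
    _ = _ := by ring

/-- ★★★ **N2b — THE FAR CASE OF THE POINTWISE FIBRE BOUND** (LEAD 23:12Z), in the letters of ✓`lintegral_hubSlab_leader_le`'s `hF`.  At a leader point `(δ = t 0; x = (t1∷u),
y = (t2∷v), z)` with `δ² ≤ 1/3`, `|u|² ≤ 1 + x₀²`, followers' signs `+`, and T1's admissibility FAILING (`¬(comm ≤ s_T ∧ σ ≤ s_T ∧ F̂(ℓ,0) ≤ κ_flat)`), for every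
`g ≤ ofReal(e^{−bF̂(hubAt δ 1, ε, ·)})` (`0 ≤ b`):
`∫⁻ F, ofReal(bDensity(pt F))·g(pt F) ≤ (ofReal(e^{−(5b/6)·κ_far})·∫⁻ F, ofReal(piWeight F)) · X · Y · Z` with the three leader Gaussians of rate `c = b/(6·55200L⁶)` and
`κ_far = min(s_T², κ_flat/(300L⁴))/(3600L⁶)`. [cite: Luscher1983, §2] -/
theorem endGauss_N2_far (ε : GnoSign L) (hε : ε.2.2 = fun _ => true) (u : ℝ × ℝ) (t : Fin 3 → ℝ) (v : Fin 2 → ℝ) (z : Fin 3 → ℝ)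
    (hδ : (t 0) ^ 2 ≤ 1 / 3) (hu : u.1 ^ 2 + u.2 ^ 2 ≤ 1 + (t 1) ^ 2) {b sT κf : ℝ} (hb : 0 ≤ b) (hsT : 0 ≤ sT) (hκf : 0 ≤ κf)
    (g : ℝ × GnoCoord L → ℝ≥0∞)
    (hg : ∀ F : Fol L → Fin 3 → ℝ, g (t 0, ((((![t 1, u.1, u.2] : Fin 3 → ℝ), (![t 2, v 0, v 1] : Fin 3 → ℝ)), (z, F)) : GnoCoord L)) ≤
      ENNReal.ofReal (Real.exp (-(b * gnoDeficit (fun _ => false) (fun _ => 1) (hubAt (t 0) 1) ε ((((![t 1, u.1, u.2] : Fin 3 → ℝ), (![t 2, v 0, v 1] : Fin 3 → ℝ)), (z, F)) : GnoCoord L)))))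
    (hfar : ¬ ((∀ μ ν : Fin 3, frobNorm ((((blowUpPoint 1 (gnomonicPoint (hubAt (t 0) 1) ε ((((![t 1, u.1, u.2] : Fin 3 → ℝ), (![t 2, v 0, v 1] : Fin 3 → ℝ)), (z, (0 : Fol L → Fin 3 → ℝ))) : GnoCoord L))).1 (Fin.castSucc μ) *
        (blowUpPoint 1 (gnomonicPoint (hubAt (t 0) 1) ε ((((![t 1, u.1, u.2] : Fin 3 → ℝ), (![t 2, v 0, v 1] : Fin 3 → ℝ)), (z, (0 : Fol L → Fin 3 → ℝ))) : GnoCoord L))).1 (Fin.castSucc ν) : SU2) : Matrix (Fin 2) (Fin 2) ℂ) -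
        (((blowUpPoint 1 (gnomonicPoint (hubAt (t 0) 1) ε ((((![t 1, u.1, u.2] : Fin 3 → ℝ), (![t 2, v 0, v 1] : Fin 3 → ℝ)), (z, (0 : Fol L → Fin 3 → ℝ))) : GnoCoord L))).1 (Fin.castSucc ν) *
        (blowUpPoint 1 (gnomonicPoint (hubAt (t 0) 1) ε ((((![t 1, u.1, u.2] : Fin 3 → ℝ), (![t 2, v 0, v 1] : Fin 3 → ℝ)), (z, (0 : Fol L → Fin 3 → ℝ))) : GnoCoord L))).1 (Fin.castSucc μ) : SU2) : Matrix (Fin 2) (Fin 2) ℂ)) ≤ sT) ∧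
      (∀ μ : Fin 3, frobNorm ((((blowUpPoint 1 (gnomonicPoint (hubAt (t 0) 1) ε ((((![t 1, u.1, u.2] : Fin 3 → ℝ), (![t 2, v 0, v 1] : Fin 3 → ℝ)), (z, (0 : Fol L → Fin 3 → ℝ))) : GnoCoord L))).1 (Fin.last 3) *
        (blowUpPoint 1 (gnomonicPoint (hubAt (t 0) 1) ε ((((![t 1, u.1, u.2] : Fin 3 → ℝ), (![t 2, v 0, v 1] : Fin 3 → ℝ)), (z, (0 : Fol L → Fin 3 → ℝ))) : GnoCoord L))).1 (Fin.castSucc (Equiv.swap (0 : Fin 3) 1 μ)) : SU2) :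
          Matrix (Fin 2) (Fin 2) ℂ) -
        (((blowUpPoint 1 (gnomonicPoint (hubAt (t 0) 1) ε ((((![t 1, u.1, u.2] : Fin 3 → ℝ), (![t 2, v 0, v 1] : Fin 3 → ℝ)), (z, (0 : Fol L → Fin 3 → ℝ))) : GnoCoord L))).1 (Fin.castSucc μ) *
        (blowUpPoint 1 (gnomonicPoint (hubAt (t 0) 1) ε ((((![t 1, u.1, u.2] : Fin 3 → ℝ), (![t 2, v 0, v 1] : Fin 3 → ℝ)), (z, (0 : Fol L → Fin 3 → ℝ))) : GnoCoord L))).1 (Fin.last 3) : SU2) : Matrix (Fin 2) (Fin 2) ℂ)) ≤ sT) ∧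
      gnoDeficit (fun _ => false) (fun _ => 1) (hubAt (t 0) 1) ε ((((![t 1, u.1, u.2] : Fin 3 → ℝ), (![t 2, v 0, v 1] : Fin 3 → ℝ)), (z, (0 : Fol L → Fin 3 → ℝ))) : GnoCoord L) ≤ κf)) :
    ∫⁻ F : Fol L → Fin 3 → ℝ,
        ENNReal.ofReal (((1 + (t 0) ^ 2)⁻¹) ^ 2 * gnoDensity ((((![t 1, u.1, u.2] : Fin 3 → ℝ), (![t 2, v 0, v 1] : Fin 3 → ℝ)), (z, F)) : GnoCoord L)) *
          g (t 0, ((((![t 1, u.1, u.2] : Fin 3 → ℝ), (![t 2, v 0, v 1] : Fin 3 → ℝ)), (z, F)) : GnoCoord L)) ≤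
      (ENNReal.ofReal (Real.exp (-(5 * b / 6 * (min (sT ^ 2) (κf / (300 * (L : ℝ) ^ 4)) / (3600 * (L : ℝ) ^ 6))))) *
          ∫⁻ F : Fol L → Fin 3 → ℝ, ENNReal.ofReal (piWeight F)) *
        ENNReal.ofReal (((1 + t 1 ^ 2 + (u.1 ^ 2 + u.2 ^ 2)) ^ 2)⁻¹ * Real.exp (-(b / (6 * (55200 * (L : ℝ) ^ 6)) *
          (16 * (t 0) ^ 2 / (1 + (t 0) ^ 2) + 8 * (t 1) ^ 2 / ((1 + (t 1) ^ 2) * (1 + (t 0) ^ 2)) + 4 * (t 2) ^ 2 / (1 + (t 2) ^ 2)) *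
          (u.1 ^ 2 + u.2 ^ 2) / (1 + t 1 ^ 2 + (u.1 ^ 2 + u.2 ^ 2))))) *
        ENNReal.ofReal (((1 + t 2 ^ 2 + (v 0 ^ 2 + v 1 ^ 2)) ^ 2)⁻¹ * Real.exp (-(b / (6 * (55200 * (L : ℝ) ^ 6)) * (v 0 ^ 2 + v 1 ^ 2) / (1 + t 2 ^ 2 + (v 0 ^ 2 + v 1 ^ 2))))) *
        ENNReal.ofReal (gnomonicWeight z * Real.exp (-(b / (6 * (55200 * (L : ℝ) ^ 6)) * normSq3 z / (1 + normSq3 z)))) := by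
  have hL0 : (0 : ℝ) < (L : ℝ) := by exact_mod_cast NeZero.pos L
  set κ : ℝ := min (sT ^ 2) (κf / (300 * (L : ℝ) ^ 4)) / (3600 * (L : ℝ) ^ 6) with hκ
  set c : ℝ := b / (6 * (55200 * (L : ℝ) ^ 6)) with hc
  have hc0 : 0 ≤ c := by rw [hc]; positivity
  have hcb : c * (55200 * (L : ℝ) ^ 6) = b / 6 := by rw [hc]; field_simp
  -- names for the three Gaussian factors (real)
  set Xr : ℝ := ((1 + t 1 ^ 2 + (u.1 ^ 2 + u.2 ^ 2)) ^ 2)⁻¹ * Real.exp (-(c *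
      (16 * (t 0) ^ 2 / (1 + (t 0) ^ 2) + 8 * (t 1) ^ 2 / ((1 + (t 1) ^ 2) * (1 + (t 0) ^ 2)) + 4 * (t 2) ^ 2 / (1 + (t 2) ^ 2)) *
      (u.1 ^ 2 + u.2 ^ 2) / (1 + t 1 ^ 2 + (u.1 ^ 2 + u.2 ^ 2)))) with hXr
  set Yr : ℝ := ((1 + t 2 ^ 2 + (v 0 ^ 2 + v 1 ^ 2)) ^ 2)⁻¹ * Real.exp (-(c * (v 0 ^ 2 + v 1 ^ 2) / (1 + t 2 ^ 2 + (v 0 ^ 2 + v 1 ^ 2)))) with hYr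
  set Zr : ℝ := gnomonicWeight z * Real.exp (-(c * normSq3 z / (1 + normSq3 z))) with hZr
  have hX0 : 0 ≤ Xr := by rw [hXr]; positivity
  have hY0 : 0 ≤ Yr := by rw [hYr]; positivity
  have hZ0 : 0 ≤ Zr := by rw [hZr]; exact mul_nonneg (Gnomonic.gnomonicWeight_pos z).le (Real.exp_pos _).le
  -- pointwise bound on the integrand
  have hpt : ∀ F : Fol L → Fin 3 → ℝ,
      ENNReal.ofReal (((1 + (t 0) ^ 2)⁻¹) ^ 2 * gnoDensity ((((![t 1, u.1, u.2] : Fin 3 → ℝ), (![t 2, v 0, v 1] : Fin 3 → ℝ)), (z, F)) : GnoCoord L)) *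
          g (t 0, ((((![t 1, u.1, u.2] : Fin 3 → ℝ), (![t 2, v 0, v 1] : Fin 3 → ℝ)), (z, F)) : GnoCoord L)) ≤
        (ENNReal.ofReal (Real.exp (-(5 * b / 6 * κ))) * ENNReal.ofReal Xr * ENNReal.ofReal Yr * ENNReal.ofReal Zr) * ENNReal.ofReal (piWeight F) := by
    intro F
    set η : GnoCoord L := ((((![t 1, u.1, u.2] : Fin 3 → ℝ), (![t 2, v 0, v 1] : Fin 3 → ℝ)), (z, F)) : GnoCoord L) with hη
    set Fh : ℝ := gnoDeficit (fun _ => false) (fun _ => 1) (hubAt (t 0) 1) ε η with hFh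
    -- the floor and the three-letter exponential split
    have hfloor : κ ≤ Fh := by
      rw [hκ, hFh, hη]; exact endGauss_far_floor (a := hubAt (t 0) 1) ε hε _ _ z hsT hκf hfar F
    have hu' : (η.1.1 1) ^ 2 + (η.1.1 2) ^ 2 ≤ 1 + (η.1.1 0) ^ 2 := by
      rw [hη]; simpa using hu
    have h3 := endGauss_exp_three_floor (L := L) (t 0) hδ ε η hu' hc0
    rw [hcb] at h3
    have e3 : Real.exp (-(b / 6 * Fh)) ≤ Xr * ((1 + t 1 ^ 2 + (u.1 ^ 2 + u.2 ^ 2)) ^ 2) * (Yr * ((1 + t 2 ^ 2 + (v 0 ^ 2 + v 1 ^ 2)) ^ 2)) * (Zr / gnomonicWeight z) := by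
      have hw : 0 < gnomonicWeight z := Gnomonic.gnomonicWeight_pos z
      have eX : Xr * ((1 + t 1 ^ 2 + (u.1 ^ 2 + u.2 ^ 2)) ^ 2) = Real.exp (-(c *
          (16 * (t 0) ^ 2 / (1 + (t 0) ^ 2) + 8 * (η.1.1 0) ^ 2 / ((1 + (η.1.1 0) ^ 2) * (1 + (t 0) ^ 2)) + 4 * (η.1.2 0) ^ 2 / (1 + (η.1.2 0) ^ 2)) *
          ((η.1.1 1) ^ 2 + (η.1.1 2) ^ 2) / (1 + (η.1.1 0) ^ 2 + ((η.1.1 1) ^ 2 + (η.1.1 2) ^ 2)))) := by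
        rw [hXr, hη]; simp only [Matrix.cons_val_zero, Matrix.cons_val_one, Matrix.cons_val]; field_simp
      have eY : Yr * ((1 + t 2 ^ 2 + (v 0 ^ 2 + v 1 ^ 2)) ^ 2) = Real.exp (-(c * ((η.1.2 1) ^ 2 + (η.1.2 2) ^ 2) / (1 + (η.1.2 0) ^ 2 + ((η.1.2 1) ^ 2 + (η.1.2 2) ^ 2)))) := by
        rw [hYr, hη]; simp only [Matrix.cons_val_zero, Matrix.cons_val_one, Matrix.cons_val]; field_simp
      have eZ : Zr / gnomonicWeight z = Real.exp (-(c * normSq3 η.2.1 / (1 + normSq3 η.2.1))) := by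
        rw [hZr, hη]; field_simp
      rw [eX, eY, eZ, hFh]
      exact h3
    -- the density and `g` at this point, in `η`-form
    have hdens : ENNReal.ofReal (((1 + (t 0) ^ 2)⁻¹) ^ 2 * gnoDensity η) ≤
        ENNReal.ofReal (((1 + t 1 ^ 2 + (u.1 ^ 2 + u.2 ^ 2)) ^ 2)⁻¹) * ENNReal.ofReal (((1 + t 2 ^ 2 + (v 0 ^ 2 + v 1 ^ 2)) ^ 2)⁻¹) * ENNReal.ofReal (gnomonicWeight z) *
          ENNReal.ofReal (piWeight F) := by
      rw [hη]; exact bDensity_blocks_le_piWeight (L := L) (t 0) u t v z F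
    have hgF : g (t 0, η) ≤ ENNReal.ofReal (Real.exp (-(b * Fh))) := by rw [hFh, hη]; exact hg F
    have hw : 0 < gnomonicWeight z := Gnomonic.gnomonicWeight_pos z
    clear_value Xr Yr Zr Fh η κ c
    -- `e^{-bF̂} = e^{-(b/6)F̂}·e^{-(5b/6)F̂} ≤ (…)·e^{-(5b/6)κ}`
    have hexp : Real.exp (-(b * Fh)) ≤ (Xr * ((1 + t 1 ^ 2 + (u.1 ^ 2 + u.2 ^ 2)) ^ 2) * (Yr * ((1 + t 2 ^ 2 + (v 0 ^ 2 + v 1 ^ 2)) ^ 2)) * (Zr / gnomonicWeight z)) *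
        Real.exp (-(5 * b / 6 * κ)) := by
      have e : Real.exp (-(b * Fh)) = Real.exp (-(b / 6 * Fh)) * Real.exp (-(5 * b / 6 * Fh)) := by rw [← Real.exp_add]; congr 1; ring
      rw [e]
      have hk : -(5 * b / 6 * Fh) ≤ -(5 * b / 6 * κ) := by
        have := mul_le_mul_of_nonneg_left hfloor (show (0:ℝ) ≤ 5 * b / 6 by positivity)
        linarith
      refine mul_le_mul e3 (Real.exp_le_exp.2 hk) (Real.exp_pos _).le ?_
      exact le_trans (Real.exp_pos _).le e3
    have hA : 0 < ((1 + t 1 ^ 2 + (u.1 ^ 2 + u.2 ^ 2)) ^ 2)⁻¹ := by positivity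
    have hB : 0 < ((1 + t 2 ^ 2 + (v 0 ^ 2 + v 1 ^ 2)) ^ 2)⁻¹ := by positivity
    calc ENNReal.ofReal (((1 + (t 0) ^ 2)⁻¹) ^ 2 * gnoDensity η) * g (t 0, η)
        ≤ (ENNReal.ofReal (((1 + t 1 ^ 2 + (u.1 ^ 2 + u.2 ^ 2)) ^ 2)⁻¹) * ENNReal.ofReal (((1 + t 2 ^ 2 + (v 0 ^ 2 + v 1 ^ 2)) ^ 2)⁻¹) * ENNReal.ofReal (gnomonicWeight z) *
            ENNReal.ofReal (piWeight F)) * ENNReal.ofReal (Real.exp (-(b * Fh))) := mul_le_mul' hdens hgF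
      _ ≤ (ENNReal.ofReal (((1 + t 1 ^ 2 + (u.1 ^ 2 + u.2 ^ 2)) ^ 2)⁻¹) * ENNReal.ofReal (((1 + t 2 ^ 2 + (v 0 ^ 2 + v 1 ^ 2)) ^ 2)⁻¹) * ENNReal.ofReal (gnomonicWeight z) *
            ENNReal.ofReal (piWeight F)) * ENNReal.ofReal ((Xr * ((1 + t 1 ^ 2 + (u.1 ^ 2 + u.2 ^ 2)) ^ 2) * (Yr * ((1 + t 2 ^ 2 + (v 0 ^ 2 + v 1 ^ 2)) ^ 2)) * (Zr / gnomonicWeight z)) *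
            Real.exp (-(5 * b / 6 * κ))) := mul_le_mul_right (ENNReal.ofReal_le_ofReal hexp) _
      _ = (ENNReal.ofReal (Real.exp (-(5 * b / 6 * κ))) * ENNReal.ofReal Xr * ENNReal.ofReal Yr * ENNReal.ofReal Zr) * ENNReal.ofReal (piWeight F) := by
          rw [ofReal_mul5 hA.le hB.le hw.le (piWeight_pos F).le, ofReal_mul5 (Real.exp_pos _).le hX0 hY0 hZ0]
          congr 1
          field_simp
  -- integrate
  calc ∫⁻ F : Fol L → Fin 3 → ℝ, ENNReal.ofReal (((1 + (t 0) ^ 2)⁻¹) ^ 2 * gnoDensity ((((![t 1, u.1, u.2] : Fin 3 → ℝ), (![t 2, v 0, v 1] : Fin 3 → ℝ)), (z, F)) : GnoCoord L)) *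
          g (t 0, ((((![t 1, u.1, u.2] : Fin 3 → ℝ), (![t 2, v 0, v 1] : Fin 3 → ℝ)), (z, F)) : GnoCoord L))
      ≤ ∫⁻ F : Fol L → Fin 3 → ℝ, (ENNReal.ofReal (Real.exp (-(5 * b / 6 * κ))) * ENNReal.ofReal Xr * ENNReal.ofReal Yr * ENNReal.ofReal Zr) * ENNReal.ofReal (piWeight F) :=
        lintegral_mono hpt
    _ = (ENNReal.ofReal (Real.exp (-(5 * b / 6 * κ))) * ENNReal.ofReal Xr * ENNReal.ofReal Yr * ENNReal.ofReal Zr) * ∫⁻ F : Fol L → Fin 3 → ℝ, ENNReal.ofReal (piWeight F) := by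
        rw [lintegral_const_mul _ (Measurable.ennreal_ofReal continuous_piWeight.measurable)]
    _ = _ := by ring

end Summit.QuantumFields.YangMills.Theorems.SwapVirialDeficit.BlowUpRing

end
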